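import Literature.NumberTheory.Automorphic.LevelActionShapiro
import Literature.NumberTheory.Automorphic.ArithmeticQuotientCohomologyFinite
import Literature.NumberTheory.Automorphic.HidaLevelNeat
import Literature.NumberTheory.Automorphic.HidaTowerLevels
import Literature.Algebra.Homology.GroupCohomologyRestrictScalars
import HarnessLib

/-!
# Vanishing of `H^q(Γ, M(U, τ))` above the cohomological dimension of the stabilisers

Topic `NumberTheory/Automorphic`; namespace `Literature.NumberTheory.Automorphic.LevelAction`;
theorems only (no new definitions, no named fact, no `sorry`).  Universe `0`.

The "`H³ = 0`" input of the exact finite-level control in the top degree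
(`LevelControlFiniteLevel`, hypotheses of B3/B4; [cite: Hida1994AIF, §3 (1.4), (TF)]) for the
coefficients-at-`p` model `M(U, τ)`: by the Shapiro decomposition
`H^q(Γ, M(U, τ)) ≅ Π_x H^q(Γ_x, V_x)` (`toOrbitCohomology_pi_bijective`),

* `subsingleton_cohomology_of_cover` — if `H^q(Γ_x, V_x) = 0` for the stabilisers `Γ_x` of a
  finite covering family of double cosets, then `H^q(Γ, M(U, τ)) = 0`;
* `subsingleton_cohomology_two` — for `GL₂` over a number field (finitely many double cosets,
  `exists_finset_orbit_cover_two`) it suffices that `H^q(Γ_x, V_x) = 0` for all `x`;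
* **`subsingleton_cohomology_two_of_cd`** — hence `H^q(Γ, M(U, τ)) = 0` for `q ≥ 3` as soon as the
  torsion-free congruence subgroups `GL₂(K) ∩ W` (`W` compact open) have cohomological dimension
  `≤ 2` (hypothesis `hcd`, the Bianchi case [cite: BorelSerre1973, §11.1]: `vcd = 2` for `K`
  imaginary quadratic) and the stabilisers `GL₂(K) ∩ x U x⁻¹` are torsion-free (`htf`);
* `TameLevel.torsionFree_stabilizer_level` — the latter holds for the Hida levels `U(b, c)` with
  `r₀ ≤ b`, `r₀ ≤ c`, `r₀` from `TameLevel.exists_forall_eq_one_of_isOfFinOrder` (`HidaLevelNeat`).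

## References

* H. Hida, Ann. Inst. Fourier 44 (1994), §1 (TF), §3. [Hida1994AIF]
* A. Borel, J.-P. Serre, *Corners and arithmetic groups*, Comment. Math. Helv. 48 (1973), §11.1.
  [BorelSerre1973]
* C. Khare, J. A. Thorne, Amer. J. Math. 139 (2017), §6.1, §6.3. [KhareThorne2017]
-/

noncomputable section

open CategoryTheory
open scoped NumberField

namespace Literature.NumberTheory.Automorphic

namespace LevelAction

open TwistedQuotient (orbitStabilizer)
open Literature.Algebra.Homology (intRep semimap_intRep_bijective)

variable {R : Type} [CommRing R] {Γ 𝒢 : Type} [Group Γ] [Group 𝒢] (ι : Γ →* 𝒢)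
  (Δ : Submonoid 𝒢) {V : Type} [AddCommGroup V] [Module R V] (τ : Δ →* Module.End R V)
  (U : Subgroup 𝒢) (hU : U.toSubmonoid ≤ Δ)

/-- **Vanishing stabiliser cohomology over a finite covering family gives `H^q(Γ, M(U, τ)) = 0`.**
[cite: Hida1994AIF, §1–2] -/
theorem subsingleton_cohomology_of_cover (s₀ : Finset 𝒢)
    (hcov : ∀ g : 𝒢, ∃ x ∈ s₀, ∃ γ : Γ, ι γ • (x : 𝒢 ⧸ U) = (g : 𝒢 ⧸ U)) (q : ℕ)
    (hvan : ∀ x ∈ s₀, Subsingleton (groupCohomology (stabilizerRep ι Δ τ U hU x) q)) :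
    Subsingleton (cohomology ι Δ τ U q) := by
  classical
  obtain ⟨s, hs, hdisj, hcov'⟩ := exists_doubleCoset_representatives ι s₀ hcov
  haveI : ∀ x : s, Subsingleton (groupCohomology (stabilizerRep ι Δ τ U hU x.1) q) :=
    fun x => hvan x.1 (hs x.2)
  exact (toOrbitCohomology_pi_bijective ι Δ τ U hU s hdisj hcov' q).1.subsingleton

/-- `H^q(G, A) = 0` iff `H^q(G, A|_ℤ) = 0`. [folklore] -/
theorem subsingleton_groupCohomology_iff_intRep {G : Type} [Group G] (A : Rep R G) (q : ℕ) :
    Subsingleton (groupCohomology A q) ↔ Subsingleton (groupCohomology (intRep A) q) :=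
  ⟨fun _ => (semimap_intRep_bijective A q).1.subsingleton,
    fun _ => (semimap_intRep_bijective A q).2.subsingleton⟩

/-- **For `GL₂` over a number field** (finitely many double cosets): `H^q(Γ, M(U, τ)) = 0` as soon
as `H^q(Γ_x, V_x) = 0` for every `x`. [cite: Hida1994AIF, §1–2] -/
theorem subsingleton_cohomology_two (K : Type) [Field K] [NumberField K]
    (U : Subgroup (BigHeckeGLn.FiniteAdelicGL 2 K))
    (hUo : IsOpen (U : Set (BigHeckeGLn.FiniteAdelicGL 2 K)))
    (Δ : Submonoid (BigHeckeGLn.FiniteAdelicGL 2 K)) (hU : U.toSubmonoid ≤ Δ)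
    (τ : Δ →* Module.End R V) (q : ℕ)
    (hvan : ∀ x : BigHeckeGLn.FiniteAdelicGL 2 K, Subsingleton
      (groupCohomology (stabilizerRep (BigHeckeGLn.globalEmbedding 2 K) Δ τ U hU x) q)) :
    Subsingleton (cohomology (BigHeckeGLn.globalEmbedding 2 K) Δ τ U q) := by
  classical
  obtain ⟨s₀, hcov⟩ := BigHeckeGLn.exists_finset_orbit_cover_two K U hUo
  refine subsingleton_cohomology_of_cover (BigHeckeGLn.globalEmbedding 2 K) Δ τ U hU
    (s₀.image Quotient.out) (fun g => ?_) q fun x _ => hvan x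
  obtain ⟨c, hc, γ, hγ⟩ := hcov (g : BigHeckeGLn.FiniteAdelicGL 2 K ⧸ U)
  refine ⟨c.out, Finset.mem_image_of_mem _ hc, γ, ?_⟩
  rw [QuotientGroup.out_eq']
  exact hγ

/-- **`H^q(Γ, M(U, τ)) = 0` for `q ≥ 3`** (`GL₂` over a number field) **given cohomological
dimension `≤ 2` of the torsion-free congruence subgroups** (`hcd`: for `W` compact open with
`GL₂(K) ∩ W` torsion-free, `H^q(GL₂(K) ∩ W, A) = 0` for all `ℤ[GL₂(K) ∩ W]`-modules `A` and
`q ≥ 3` — the Bianchi case `vcd = 2`) and torsion-free stabilisers `GL₂(K) ∩ x U x⁻¹` (`htf`).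
[cite: BorelSerre1973, §11.1] [cite: Hida1994AIF, §1 (TF)] -/
theorem subsingleton_cohomology_two_of_cd (K : Type) [Field K] [NumberField K]
    (hcd : ∀ (W : Subgroup (BigHeckeGLn.FiniteAdelicGL 2 K)),
      IsOpen (W : Set (BigHeckeGLn.FiniteAdelicGL 2 K)) →
      IsCompact (W : Set (BigHeckeGLn.FiniteAdelicGL 2 K)) →
      (∀ γ ∈ W.comap (BigHeckeGLn.globalEmbedding 2 K), IsOfFinOrder γ → γ = 1) →
      ∀ (A : Rep ℤ (W.comap (BigHeckeGLn.globalEmbedding 2 K))) (q : ℕ), 3 ≤ q →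
        Subsingleton (groupCohomology A q))
    (U : Subgroup (BigHeckeGLn.FiniteAdelicGL 2 K))
    (hUo : IsOpen (U : Set (BigHeckeGLn.FiniteAdelicGL 2 K)))
    (hUc : IsCompact (U : Set (BigHeckeGLn.FiniteAdelicGL 2 K)))
    (htf : ∀ (x : BigHeckeGLn.FiniteAdelicGL 2 K) (γ : GL (Fin 2) K), IsOfFinOrder γ →
      x⁻¹ * BigHeckeGLn.globalEmbedding 2 K γ * x ∈ U → γ = 1)
    (Δ : Submonoid (BigHeckeGLn.FiniteAdelicGL 2 K)) (hU : U.toSubmonoid ≤ Δ)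
    (τ : Δ →* Module.End R V) {q : ℕ} (hq : 3 ≤ q) :
    Subsingleton (cohomology (BigHeckeGLn.globalEmbedding 2 K) Δ τ U q) := by
  refine subsingleton_cohomology_two K U hUo Δ hU τ q fun x => ?_
  rw [subsingleton_groupCohomology_iff_intRep]
  refine hcd (MulAction.stabilizer (BigHeckeGLn.FiniteAdelicGL 2 K) (x : BigHeckeGLn.FiniteAdelicGL 2 K ⧸ U))
    (TwistedQuotient.isOpen_stabilizer_coe U hUo _) (TwistedQuotient.isCompact_stabilizer_coe U hUc _)
    (fun γ hγ hfin => htf x γ hfin ?_) _ q hq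
  rw [Subgroup.mem_comap, MulAction.mem_stabilizer_iff, MulAction.Quotient.smul_coe, smul_eq_mul,
    QuotientGroup.eq] at hγ
  have h' := inv_mem hγ
  rwa [show ((BigHeckeGLn.globalEmbedding 2 K γ * x)⁻¹ * x)⁻¹ =
    x⁻¹ * BigHeckeGLn.globalEmbedding 2 K γ * x by group] at h'

end LevelAction

namespace BigHeckeGLn.TameLevel

variable {K : Type} [Field K] [NumberField K] {p : ℕ} [Fact p.Prime] (𝒰 : TameLevel 2 K p)

/-- **The stabilisers `GL₂(K) ∩ x U(b, c) x⁻¹` are torsion-free for `b, c ≥ r₀`** with `r₀` as in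
`exists_forall_eq_one_of_isOfFinOrder` (`U(b, c) ≤ U(r₀) = U(r₀, max r₀ 1)`).
[cite: Hida1994AIF, §1 (TF)] [cite: KhareThorne2017, §6.1] -/
theorem torsionFree_stabilizer_level {r₀ : ℕ}
    (hr₀ : ∀ r : ℕ, r₀ ≤ r → ∀ (g : FiniteAdelicGL 2 K) (γ : GL (Fin 2) K), IsOfFinOrder γ →
      g⁻¹ * globalEmbedding 2 K γ * g ∈ 𝒰.hidaLevel r → γ = 1)
    {b c : ℕ} (hb : r₀ ≤ b) (hc : r₀ ≤ c) (hc1 : 1 ≤ c)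
    (x : FiniteAdelicGL 2 K) (γ : GL (Fin 2) K) (hfin : IsOfFinOrder γ)
    (hx : x⁻¹ * globalEmbedding 2 K γ * x ∈ 𝒰.level b c) : γ = 1 :=
  hr₀ r₀ le_rfl x γ hfin (by
    rw [𝒰.hidaLevel_eq_level]
    exact 𝒰.level_antitone hb (max_le hc hc1) hx)

/-- **`H^q(Γ, M(U(b,c), τ)) = 0` for `q ≥ 3` at deep Hida levels** (`b, c ≥ r₀`, `c ≥ 1`), given
`hcd`. [cite: Hida1994AIF, §1 (TF), §3] [cite: BorelSerre1973, §11.1] -/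
theorem subsingleton_levelActionCohomology_level_of_cd {R : Type} [CommRing R] {V : Type}
    [AddCommGroup V] [Module R V]
    (hcd : ∀ (W : Subgroup (FiniteAdelicGL 2 K)),
      IsOpen (W : Set (FiniteAdelicGL 2 K)) → IsCompact (W : Set (FiniteAdelicGL 2 K)) →
      (∀ γ ∈ W.comap (globalEmbedding 2 K), IsOfFinOrder γ → γ = 1) →
      ∀ (A : Rep ℤ (W.comap (globalEmbedding 2 K))) (q : ℕ), 3 ≤ q →
        Subsingleton (groupCohomology A q))
    {r₀ : ℕ}
    (hr₀ : ∀ r : ℕ, r₀ ≤ r → ∀ (g : FiniteAdelicGL 2 K) (γ : GL (Fin 2) K), IsOfFinOrder γ →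
      g⁻¹ * globalEmbedding 2 K γ * g ∈ 𝒰.hidaLevel r → γ = 1)
    {b c : ℕ} (hb : r₀ ≤ b) (hc : r₀ ≤ c) (hc1 : 1 ≤ c)
    (Δ : Submonoid (FiniteAdelicGL 2 K)) (hU : (𝒰.level b c).toSubmonoid ≤ Δ)
    (τ : Δ →* Module.End R V) {q : ℕ} (hq : 3 ≤ q) :
    Subsingleton (LevelAction.cohomology (globalEmbedding 2 K) Δ τ (𝒰.level b c) q) :=
  LevelAction.subsingleton_cohomology_two_of_cd K hcd (𝒰.level b c) (𝒰.isOpen_level b c)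
    (𝒰.isCompact_level b c) (fun x γ hfin hx => 𝒰.torsionFree_stabilizer_level hr₀ hb hc hc1 x γ hfin hx)
    Δ hU τ hq

end BigHeckeGLn.TameLevel

end Literature.NumberTheory.Automorphic
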